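import Literature.Geometry.Lorentzian.ExactKerrEnd
import Literature.Geometry.Lorentzian.KerrDataSchwarzschildExtrinsic
import Literature.Geometry.Lorentzian.KerrSliceFacts
import Literature.Geometry.Lorentzian.KerrConvergenceProofs
import Literature.Geometry.Lorentzian.ModelData
import HarnessLib

/-!
# The trivial datum has an exact Kerr end (`M = 0`): non-vacuity of `HasExactKerrEnd` at an
# admissible datum

Sequel to `ExactKerrEnd.lean` (definition request `defn-HasExactKerrEnd` of route `ExactKerrEnds`
of the final-state summit), everything PROVED, no definitions. `ExactKerrEnd.lean` records that the
Kerr–Schild slice data `Kerr.data M a r₀ hM` are Kerr-ended with empty exceptional set; those data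
live on the punctured slice `Kerr.slice a r₀`, which is not complete, hence never admissible
(`admissibleVacuumData`). The one admissible datum certified in the tree is the trivial datum
`(ℝ³, δ, 0)` (`trivialData`, `trivialData_mem_admissibleVacuumData`); this file shows it is
Kerr-ended, with Kerr parameters `M = 0`, `a = 0`, chart floor `r₀ = 1`:

* `Kerr.hRep_zero_mass`, `Kerr.kRep_zero_mass` — the closed forms of the Schwarzschild slice
  data (`KerrDataSchwarzschildMetric/Extrinsic.lean`) at `M = 0` are `δ` and `0`;
* `Kerr.bilin_sliceEmbed_zero_mass`, `Kerr.secondFundamentalForm_sliceEmbed_zero_mass` — on the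
  slice `{t* = 0} ∩ {‖y‖ > max r₀ 0}` of the `M = 0` Kerr–Schild chart (the metric is `η`,
  `Kerr.bilin_zero_left`) the induced metric on `v, w` is `⟪v, w⟫` and the future second
  fundamental form of `y ↦ (0, y)` w.r.t. `Kerr.sliceNormal 0 0 r₀ = ∂_{t*}` vanishes;
* `trivialData_isExactKerrEndAlong` — **exact Kerr end data for the trivial datum**: exceptional
  set the closed unit ball `K = {‖y‖ ≤ 1}` (compact), `U = Kerr.slice 0 1 = {‖y‖ > 1}`, `φ` the
  inclusion `U ↪ Minkowski.slice = ℝ³` (a smooth open embedding covering `ℝ³ ∖ K`, identity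
  differential), `ψ = Kerr.sliceEmbed 0 1`, `ν = Kerr.sliceNormal 0 0 1` (an injective spacelike
  immersion with future unit normal, `Kerr.isSpacelikeImmersion_sliceEmbed_holds`,
  `Kerr.isFutureUnitNormal_sliceNormal_holds`), and off `K`: `δ(v, w) = η((0,v),(0,w))`,
  `0 = K_ν`;
* `hasExactKerrEnd_trivialData : trivialData.HasExactKerrEnd` — hence the let-bound legend
  `KerrEnded` of the four items of route `ExactKerrEnds` holds at the trivial datum
  (`InitialDataSet.hasExactKerrEnd_iff`), and along its breathing curves
  (`HasExactKerrEnd.breatheFamily`).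

References: Corvino–Schoen, J. Differential Geom. 73 (2006), §1 (data exactly Kerr outside a
compact set); Cook, Living Rev. Relativ. 3 (2000) 5, §3.2.2, (55)–(57) (Kerr–Schild slice data;
at `M = 0` they are flat); Dafermos–Rodnianski, arXiv:0811.0354, §5.1 (the ingoing chart).
-/

noncomputable section

open Set Function TopologicalSpace Manifold
open scoped Manifold ContDiff Topology InnerProductSpace

namespace Literature.Geometry.Lorentzian

namespace Kerr

/-! ### The Schwarzschild closed forms at `M = 0` -/

/-- At `M = 0` the closed form of the slice metric is `δ`: `hRep 0 y v w = ⟪v, w⟫`.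
[cite: Cook2000, §3.2.2 (55)] -/
theorem hRep_zero_mass (y v w : E3) : hRep 0 y v w = ⟪v, w⟫_ℝ := by
  rw [hRep_apply]
  ring

/-- At `M = 0` the closed form of the second fundamental form of the slice vanishes:
`kRep 0 y v w = 0`. [cite: Cook2000, §3.2.2 (57)] -/
theorem kRep_zero_mass (y v w : E3) : kRep 0 y v w = 0 := by
  rw [kRep]
  ring

/-- **On the `M = 0` Kerr–Schild slice the ambient metric restricted to the slice is `δ`**:
`g_{0,0}((0, y))(d(sliceEmbed) v, d(sliceEmbed) w) = ⟪v, w⟫` (`g_{0,a} = η`,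
`d(sliceEmbed) v = (0, v)`). [cite: Cook2000, §3.2.2 (55)] -/
theorem bilin_sliceEmbed_zero_mass {r₀ : ℝ} (y : slice 0 r₀) (v w : E3) :
    bilin 0 0 (sliceEmbed 0 r₀ y : E4) (mfderiv 𝓘(ℝ, E3) 𝓘(ℝ, E4) (sliceEmbed 0 r₀) y v)
        (mfderiv 𝓘(ℝ, E3) 𝓘(ℝ, E4) (sliceEmbed 0 r₀) y w) = ⟪v, w⟫_ℝ := by
  rw [mfderiv_sliceEmbed_apply, mfderiv_sliceEmbed_apply, coe_sliceEmbed,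
    bilin_zero_ofTimeSpace 0 (ne_zero_of_mem_slice_zero y) v w, hRep_zero_mass]

/-- **The future second fundamental form of the `M = 0` Kerr–Schild slice vanishes**: for the flat
chart `({r > max r₀ 0}, η)` the slice `y ↦ (0, y)` with its future unit normal
`Kerr.sliceNormal 0 0 r₀` (`= ∂_{t*}`) is totally geodesic, `K_ν(v, w) = kRep 0 y v w = 0`
(`Kerr.data_k_zero_apply` at `M = 0`; the Levi-Civita instance is arbitrary, `HasLeviCivita`
being a `Prop`). [cite: Cook2000, §3.2.2 (57)] -/
theorem secondFundamentalForm_sliceEmbed_zero_mass [Facts] {r₀ : ℝ}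
    [(smoothMetric 0 0 r₀).HasLeviCivita] (y : slice 0 r₀) (v w : E3) :
    (smoothMetric 0 0 r₀).secondFundamentalForm 𝓘(ℝ, E3) (sliceEmbed 0 r₀) (sliceNormal 0 0 r₀)
      y v w = 0 := by
  haveI : SliceFacts := sliceFacts_holds
  have h := data_k_zero_apply 0 le_rfl y v w
  rw [data_k, sliceK_apply, kRep_zero_mass] at h
  convert h using 2

/-- Points of `Kerr.slice 0 1` are the points of norm `> 1`. [folklore] -/
theorem mem_slice_zero_one_iff {y : E3} : y ∈ slice 0 1 ↔ 1 < ‖y‖ := by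
  rw [mem_slice_zero_iff, max_eq_left zero_le_one]

end Kerr

/-! ### Exact Kerr end data for the trivial datum -/

/-- The Kerr–Schild slice `Kerr.slice a r₀ ⊆ ℝ³` lies in the Minkowski slice `ℝ³ = ⊤`.
[folklore] -/
theorem Kerr.slice_le_minkowskiSlice (a r₀ : ℝ) : Kerr.slice a r₀ ≤ Minkowski.slice :=
  fun _ _ ↦ trivial

/-- The exceptional compact set of the trivial datum's Kerr end: the closed unit ball of the
Minkowski slice. [folklore] -/
theorem isCompact_minkowskiSlice_closedUnitBall :
    IsCompact {y : Minkowski.slice | ‖(y : E3)‖ ≤ 1} := by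
  have hset : {y : Minkowski.slice | ‖(y : E3)‖ ≤ 1} =
      ((↑) : Minkowski.slice → E3) ⁻¹' Metric.closedBall (0 : E3) 1 := by
    ext y
    simp
  rw [hset]
  have hcl : IsClosed ((Minkowski.slice : Opens E3) : Set E3) := by
    simp [Minkowski.slice]
  exact hcl.isClosedEmbedding_subtypeVal.isCompact_preimage (isCompact_closedBall (0 : E3) 1)

/-- **Exact Kerr end data for the trivial datum `(ℝ³, δ, 0)`** with `M = 0`, `a = 0`, `r₀ = 1`:
exceptional set `K = {‖y‖ ≤ 1}`, chart `U = Kerr.slice 0 1 = {‖y‖ > 1}` included in `ℝ³`, leaf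
`ψ = Kerr.sliceEmbed 0 1 : y ↦ (0, y)` into the flat Kerr–Schild chart `({‖x⃗‖ > 1}, η)` with future
unit normal `Kerr.sliceNormal 0 0 1 = ∂_{t*}`. The inclusion is a smooth open embedding with
identity differential covering `ℝ³ ∖ K`; the leaf is an injective spacelike immersion with future
unit normal (`Kerr.isSpacelikeImmersion_sliceEmbed_holds`, `Kerr.isFutureUnitNormal_sliceNormal_holds`
at `M = 0`); the induced metric is `δ` (`Kerr.bilin_sliceEmbed_zero_mass`) and the future second
fundamental form is `0 = k` (`Kerr.secondFundamentalForm_sliceEmbed_zero_mass`). Cook 2000,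
§3.2.2 at `M = 0`; Corvino–Schoen 2006, §1. [cite: Cook2000, §3.2.2 (55)–(57)] -/
theorem trivialData_isExactKerrEndAlong [Kerr.Facts] :
    trivialData.IsExactKerrEndAlong {y : Minkowski.slice | ‖(y : E3)‖ ≤ 1} (Kerr.slice 0 1)
      0 0 1 le_rfl (Opens.inclusion (Kerr.slice_le_minkowskiSlice 0 1)) (Kerr.sliceEmbed 0 1)
      (Kerr.sliceNormal 0 0 1) := by
  have hle : Kerr.slice 0 1 ≤ Minkowski.slice := Kerr.slice_le_minkowskiSlice 0 1
  refine ⟨isCompact_minkowskiSlice_closedUnitBall, ?_, Opens.isOpenEmbedding_of_le hle,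
    contMDiff_inclusion hle, Kerr.sliceEmbed_injective 0 1,
    Kerr.isSpacelikeImmersion_sliceEmbed_holds 0 0 1 le_rfl,
    Kerr.isFutureUnitNormal_sliceNormal_holds 0 0 1 le_rfl, fun y v w _ ↦ ?_, ?_⟩
  · -- the chart covers the complement of the closed unit ball
    intro y hy
    have hy' : 1 < ‖(y : E3)‖ := lt_of_not_ge hy
    exact ⟨⟨(y : E3), Kerr.mem_slice_zero_one_iff.2 hy'⟩, rfl⟩
  · -- the metric clause: `δ(v, w) = η((0, v), (0, w))`
    rw [OpensChart.mfderiv_inclusion_apply, OpensChart.mfderiv_inclusion_apply,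
      Kerr.bilin_sliceEmbed_zero_mass, trivialData_h_inner]
    rfl
  · -- the second fundamental form clause: `0 = K_ν`
    intro _ y v w _
    rw [Kerr.secondFundamentalForm_sliceEmbed_zero_mass, trivialData_k]
    rfl

/-- **The trivial datum `(ℝ³, δ, 0)` has an exact Kerr end** (`M = 0`): non-vacuity of
`InitialDataSet.HasExactKerrEnd` — the let-bound legend `KerrEnded` of the items of route
`ExactKerrEnds` (`InitialDataSet.hasExactKerrEnd_iff`) — at an ADMISSIBLE datum
(`trivialData_mem_admissibleVacuumData`). Cook 2000, §3.2.2 at `M = 0`; Corvino–Schoen 2006, §1.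
[cite: CorvinoSchoen2006, §1 and Thm. 4] -/
theorem hasExactKerrEnd_trivialData : trivialData.HasExactKerrEnd := by
  intro _
  exact ⟨{y : Minkowski.slice | ‖(y : E3)‖ ≤ 1}, Kerr.slice 0 1, 0, 0, 1, le_rfl,
    Opens.inclusion (Kerr.slice_le_minkowskiSlice 0 1), Kerr.sliceEmbed 0 1, Kerr.sliceNormal 0 0 1,
    trivialData_isExactKerrEndAlong⟩

end Literature.Geometry.Lorentzian

end
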